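import Summits.SmoothPoincare4.SmoothPoincare4.Theses.EntropyRung
import Literature.Geometry.Riemannian.PICSphereFacts
import Literature.Geometry.Riemannian.TwoPositiveCurvatureOperator
import Literature.AlgebraicTopology.FundamentalGroup.SphereSimplyConnected
import HarnessLib

/-!
# Route EntropyRung — door P of crux `CompactShrinkerGap`: positive isotropic curvature

Crux stmt-SmoothPoincare4-10870 (`EntropyRung.CompactShrinkerGap`): a closed `M ≃ₕ S⁴` carrying a
normalised gradient shrinker `Ric + Hess f = g/2`, `R + |∇f|² = f` of Gaussian mass
`∫ e^{-f} dV > 32π²√π e^{-3/2}` (density above `Θ(S³×ℝ)`) is diffeomorphic to `S⁴`.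

Doors recorded so far (line `cgy-variance-pivot`, skeleton v17): A (Weyl / variance budget, through
Chang–Gursky–Yang), E (the dense shrinker is Einstein, through Gursky's gap + Killing–Hopf), M (the
potential is Morse with two critical points, through Milnor + Cerf), C (ν-summit). All of E, M ask for a
CLOSED condition on the dense shrinker. This file records the OPEN-CONDITION door:

* **door P** — the dense shrinker has positive isotropic curvature (`g.HasPositiveIsotropicCurvature`,
  Micallef–Moore; an open condition in `C²`). Hamilton's PIC sphere theorem (named fact
  `hamilton_pic_sphere_four`, Hamilton 1997 Cor. 1.2(a), completed by Chen–Zhu 2006) and `π₁(M) = 1`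
  (PROVED: `simplyConnectedSpace_euclideanSphere 4` transported along `M ≃ₕ S⁴`) then give `M ≅ S⁴`.
  `helper_picDoorReduction`: `hamilton_pic_sphere_four →` (crux data `⇒` PIC) `→ CompactShrinkerGap`.
* the two stronger pointwise positivity conditions the tree already relates to PIC close the crux the same
  way: `helper_picOneDoorReduction` (PIC1, Brendle 2008; `HasPIC1.hasPositiveIsotropicCurvature`) and
  `helper_twoPositiveDoorReduction` (2-positive curvature operator, Böhm–Wilking 2008;
  `HasTwoPositiveCurvatureOperator.hasPositiveIsotropicCurvature`) — no Böhm–Wilking / Brendle convergence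
  theorem is needed, Hamilton's PIC theorem absorbs both.

Why door P is worth recording although, by Li–Ni–Wang 2018 (compact 4-d shrinkers with PIC are round
quotients), its content on the standard `S⁴` equals door E's: PIC is OPEN, so door P is exactly the
interface an almost-rigidity argument can hit — "dense ⇒ `C²`-close to `S⁴(√6)` ⇒ PIC" needs compactness +
rigidity of the equality case, not an effective isolation radius; door E ("dense ⇒ Einstein") cannot be
reached that way. Nothing here claims the PIC typing is provable: it is research-open like every other
typing of this crux (no printed theorem derives a pointwise curvature positivity of a compact 4-d shrinker
from its Gaussian density).

References: R. S. Hamilton, Comm. Anal. Geom. 5 (1997), Cor. 1.2(a) [Hamilton1997]; B.-L. Chen, X.-P. Zhu,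
J. Differential Geom. 74 (2006) [ChenZhu2006]; M. Micallef, J. D. Moore, Ann. of Math. 127 (1988) §1
[MicallefMoore1988]; S. Brendle, Duke Math. J. 145 (2008) §1 [Brendle2008]; C. Böhm, B. Wilking, Ann. of
Math. 167 (2008) p. 1079 [BohmWilking2008]; X. Li, L. Ni, K. Wang, IMRN 2018 (3) 949–959 [LiNiWang2016];
H.-D. Cao, R. S. Hamilton, T. Ilmanen, arXiv:math/0404165 §4 [CaoHamiltonIlmanen2004].
-/

-- the registered namespace `Summit.SmoothPoincare4.SmoothPoincare4.Theorems` repeats a component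
set_option linter.dupNamespace false

noncomputable section

open scoped Manifold ContDiff ContinuousMap

namespace Summit.SmoothPoincare4.SmoothPoincare4.Theorems

open Summit.SmoothPoincare4.SmoothPoincare4.Theses.EntropyRung

/-- **Door P of `CompactShrinkerGap` (registered helper `helper_picDoorReduction`).** Under Hamilton's
PIC sphere theorem (`hHam`, named fact): IF every dense normalised gradient shrinker on a closed homotopy
4-sphere — `Ric + Hess f = g/2`, `R + |∇f|² = f`, `∫ e^{-f} dV > 32π²√π e^{-3/2}` — has positive
isotropic curvature (hypothesis `hP`, the registered typing `stub_densePIC` of line `cgy-variance-pivot`),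
THEN the route decl `EntropyRung.CompactShrinkerGap` holds: `M ≃ₕ S⁴` is simply connected
(`simplyConnectedSpace_euclideanSphere 4`, `HomotopyEquiv.simplyConnectedSpace_iff`) and Hamilton's
theorem applies to `(M, g)`.
[cite: Hamilton1997, Cor. 1.2(a)] [cite: ChenZhu2006, Thm. 1.1 and Cor. 1.2] [cite: CaoHamiltonIlmanen2004, §4] -/
theorem helper_picDoorReduction :
    Literature.Geometry.Riemannian.hamilton_pic_sphere_four →
    (∀ (M : Type) [TopologicalSpace M] [T2Space M] [SecondCountableTopology M]
      [ChartedSpace (EuclideanSpace ℝ (Fin 4)) M] [IsManifold (𝓡 4) ∞ M] [CompactSpace M]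
      [T3Space M] [MeasurableSpace M] [BorelSpace M],
      M ≃ₕ Metric.sphere (0 : EuclideanSpace ℝ (Fin 5)) 1 →
    ∀ (g : Literature.Geometry.Lorentzian.PseudoRiemannianMetric (𝓡 4) ∞ (EuclideanSpace ℝ (Fin 4))
        (TangentSpace (𝓡 4) : M → Type _)) [g.HasLeviCivita] (f : M → ℝ) (hg : g.IsRiemannian),
      ContMDiff (𝓡 4) 𝓘(ℝ, ℝ) ∞ f →
      (∀ (x : M) (X Y : TangentSpace (𝓡 4) x),
        g.ricci x X Y + g.hessian f x X Y = (1 / 2 : ℝ) * g.val x X Y) →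
      (∀ x : M, g.scalarCurvature x + g.gradSq f x = f x) →
      ENNReal.ofReal (32 * Real.pi ^ 2 * Real.sqrt Real.pi * Real.exp (-(3 : ℝ) / 2)) <
        ∫⁻ x, ENNReal.ofReal (Real.exp (-f x))
          ∂(Literature.Geometry.Lorentzian.riemannianMeasure (g.toContMDiffRiemannianMetric hg)) →
      g.HasPositiveIsotropicCurvature) →
    Summit.SmoothPoincare4.SmoothPoincare4.Theses.EntropyRung.CompactShrinkerGap := by
  intro hHam hP
  unfold CompactShrinkerGap
  intro M _ _ _ _ _ _ _ _ _ e g _ f hg hf hsol hnorm hdens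
  haveI : SimplyConnectedSpace (Metric.sphere (0 : EuclideanSpace ℝ (Fin (4 + 1))) 1) :=
    Literature.AlgebraicTopology.FundamentalGroup.simplyConnectedSpace_euclideanSphere 4
      (by norm_num)
  haveI : SimplyConnectedSpace M := e.simplyConnectedSpace_iff.2 inferInstance
  exact hHam M ⟨g, hg, hP M e g f hg hf hsol hnorm hdens⟩

/-- **Door P through PIC1 (registered helper `helper_picOneDoorReduction`).** The same reduction with
the stronger typing "dense ⇒ PIC1" (Brendle's condition (2) at `λ = 1` and beyond); PIC1 ⇒ PIC is
`HasPIC1.hasPositiveIsotropicCurvature` (proved in the tree), so Hamilton's theorem still closes.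
[cite: Brendle2008, §1, p. 2] [cite: Hamilton1997, Cor. 1.2(a)] -/
theorem helper_picOneDoorReduction :
    Literature.Geometry.Riemannian.hamilton_pic_sphere_four →
    (∀ (M : Type) [TopologicalSpace M] [T2Space M] [SecondCountableTopology M]
      [ChartedSpace (EuclideanSpace ℝ (Fin 4)) M] [IsManifold (𝓡 4) ∞ M] [CompactSpace M]
      [T3Space M] [MeasurableSpace M] [BorelSpace M],
      M ≃ₕ Metric.sphere (0 : EuclideanSpace ℝ (Fin 5)) 1 →
    ∀ (g : Literature.Geometry.Lorentzian.PseudoRiemannianMetric (𝓡 4) ∞ (EuclideanSpace ℝ (Fin 4))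
        (TangentSpace (𝓡 4) : M → Type _)) [g.HasLeviCivita] (f : M → ℝ) (hg : g.IsRiemannian),
      ContMDiff (𝓡 4) 𝓘(ℝ, ℝ) ∞ f →
      (∀ (x : M) (X Y : TangentSpace (𝓡 4) x),
        g.ricci x X Y + g.hessian f x X Y = (1 / 2 : ℝ) * g.val x X Y) →
      (∀ x : M, g.scalarCurvature x + g.gradSq f x = f x) →
      ENNReal.ofReal (32 * Real.pi ^ 2 * Real.sqrt Real.pi * Real.exp (-(3 : ℝ) / 2)) <
        ∫⁻ x, ENNReal.ofReal (Real.exp (-f x))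
          ∂(Literature.Geometry.Lorentzian.riemannianMeasure (g.toContMDiffRiemannianMetric hg)) →
      g.HasPIC1) →
    Summit.SmoothPoincare4.SmoothPoincare4.Theses.EntropyRung.CompactShrinkerGap := by
  intro hHam hP
  refine helper_picDoorReduction hHam ?_
  intro M _ _ _ _ _ _ _ _ _ e g _ f hg hf hsol hnorm hdens
  exact (hP M e g f hg hf hsol hnorm hdens).hasPositiveIsotropicCurvature

/-- **Door P through the 2-positive curvature operator (registered helper
`helper_twoPositiveDoorReduction`).** The same reduction with the strongest of the three pointwise
positivity typings, "dense ⇒ 2-positive curvature operator" (Böhm–Wilking's hypothesis); 2-positive ⇒ PIC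
is `HasTwoPositiveCurvatureOperator.hasPositiveIsotropicCurvature` (proved in the tree, `2 ≤ 4`), so
Hamilton's theorem closes and Böhm–Wilking's convergence theorem is not needed.
[cite: BohmWilking2008, Introduction, p. 1079] [cite: Hamilton1997, Cor. 1.2(a)] -/
theorem helper_twoPositiveDoorReduction :
    Literature.Geometry.Riemannian.hamilton_pic_sphere_four →
    (∀ (M : Type) [TopologicalSpace M] [T2Space M] [SecondCountableTopology M]
      [ChartedSpace (EuclideanSpace ℝ (Fin 4)) M] [IsManifold (𝓡 4) ∞ M] [CompactSpace M]
      [T3Space M] [MeasurableSpace M] [BorelSpace M],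
      M ≃ₕ Metric.sphere (0 : EuclideanSpace ℝ (Fin 5)) 1 →
    ∀ (g : Literature.Geometry.Lorentzian.PseudoRiemannianMetric (𝓡 4) ∞ (EuclideanSpace ℝ (Fin 4))
        (TangentSpace (𝓡 4) : M → Type _)) [g.HasLeviCivita] (f : M → ℝ) (hg : g.IsRiemannian),
      ContMDiff (𝓡 4) 𝓘(ℝ, ℝ) ∞ f →
      (∀ (x : M) (X Y : TangentSpace (𝓡 4) x),
        g.ricci x X Y + g.hessian f x X Y = (1 / 2 : ℝ) * g.val x X Y) →
      (∀ x : M, g.scalarCurvature x + g.gradSq f x = f x) →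
      ENNReal.ofReal (32 * Real.pi ^ 2 * Real.sqrt Real.pi * Real.exp (-(3 : ℝ) / 2)) <
        ∫⁻ x, ENNReal.ofReal (Real.exp (-f x))
          ∂(Literature.Geometry.Lorentzian.riemannianMeasure (g.toContMDiffRiemannianMetric hg)) →
      g.HasTwoPositiveCurvatureOperator) →
    Summit.SmoothPoincare4.SmoothPoincare4.Theses.EntropyRung.CompactShrinkerGap := by
  intro hHam hP
  refine helper_picDoorReduction hHam ?_
  intro M _ _ _ _ _ _ _ _ _ e g _ f hg hf hsol hnorm hdens
  exact (hP M e g f hg hf hsol hnorm hdens).hasPositiveIsotropicCurvature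
    (WithTop.coe_le_coe.2 le_top)

end Summit.SmoothPoincare4.SmoothPoincare4.Theorems

end
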